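import Mathlib.MeasureTheory.Measure.Lebesgue.EqHaar
import Mathlib.MeasureTheory.Measure.Haar.InnerProductSpace
import Mathlib.MeasureTheory.Measure.Lebesgue.Complex
import Mathlib.LinearAlgebra.Complex.FiniteDimensional
import Mathlib.Analysis.SpecialFunctions.Log.Basic
import Mathlib.Analysis.Normed.Module.Ball.Pointwise
import Literature.IUT.LogVolume.ArchimedeanTensorCopiesProofs
import HarnessLib

/-!
# [IUTchIV] Theorem 1.10, proof, Step (vii): the normalised log-volume on an archimedean tensor packet,
# the container `π^{j+1}·B_I` and its log-volume `(j+1)·log(π)`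

Mochizuki, *Inter-universal Teichmüller theory IV*, RIMS manuscript (Apr. 2020; = PRIMS **57** (2021)),
proof of Theorem 1.10, Step (vii), kurims pp. 29–30 (read on the page, `paper:url-56bcb0f95768`):
"let `v_ℚ ∈ 𝕍^arc_ℚ` … by taking `I` to be `S^±_{j+1}` [so `|I| = j+1`] … it follows from Proposition
1.5, (iii), (iv), that `π^{j+1}·B_I` serves as a container for the “union of possible images of a Θ-pilot
object” … [which] contains the elements of `M_I` obtained by forming the tensor product of elements of the
log-shells … an upper bound … may be obtained by computing an upper bound for the log-volume of this
container. Such an upper bound `(j+1)·log(π)` follows immediately from the fact that [… cf. [IUTchIII],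
Prop. 3.9, (iii)] the log-volume of `B_I` is equal to `0`."

WHAT IS HERE (classical measure theory over the REAL objects of `ArchimedeanTensorCopies*`: `M_I` as
Mathlib's `PiTensorProduct`, decompositions `Φ : M_I ≅ₐ[ℝ] ⊕_{j∈J} ℂ`, `B_I = ball Φ`):
* on the archimedean packet `⊕_{j∈J} ℂ` (`J → ℂ`, sup norm, Lebesgue `volume`, a Haar measure) the
  NORMALISED LOG-VOLUME `nlogVol S := (dim_ℝ)⁻¹·(log vol(S) − log vol(B))`, `B = unitBall J = {∀ j, |y_j| ≤ 1}`.
  The text's "packet-normalization" ([IUTchIII] Prop. 3.9 (i), archimedean case, pp. 115–116) is "the sum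
  of the RADIAL log-volumes [[AbsTopIII] Prop. 5.7 (ii): length of the radial projection] on each of the
  direct summand complex archimedean fields … [with] normalized weights … the log-volume of [the product of
  the unit balls] is equal to zero … multiplication … by `e` corresponds to adding … `1 = log(e)`". MODELLING
  DECISION: `nlogVol` is the Haar-measure functional with the same two normalisations (`nlogVol_unitBall`,
  `nlogVol_exp_one_smul`; scaling by `c ∈ ℝ^×` adds `log|c|`, `nlogVol_smul`); it AGREES with the printed
  radial recipe on the sets whose log-volumes the theory computes — integral structures, hull-sets
  `⊕_j λ_j·𝒪`, holomorphic hulls (all polydiscs): `nlogVol (⊕_j λ_j·𝒪) = (1/|J|)·Σ_j log|λ_j|`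
  (`nlogVol_polydisc`) — and differs from it on non-product sets (annuli), which never occur as hulls;
  monotonicity (`nlogVol_mono`); `nlogVol (r^n·B) = n·log r`;
* transport to `M_I` along any decomposition `Φ` (`packetLogVol Φ S := nlogVol (Φ '' S)`, `image_ball`;
  `B_I` is independent of `Φ`, `ball_eq_ball`);
* **the Step (vii) container**: `⊗_i m_i ∈ r^{|I|}·B_I` whenever every `ℂ_v`-component of every `m_i` has
  length `≤ r` (`tprod_mem_pow_smul_ball_of_norm_le`, the `≤`-form of Prop. 1.5 (iv)), and
  **`packetLogVol Φ (π^{|I|}·B_I) = |I|·log(π)`** (`packetLogVol_pi_pow_smul_ball`; `|I| = j+1` gives the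
  printed `(j+1)·log(π)`), with the monotone consequence for containers `C ⊆ π^{|I|}·B_I` of positive volume
  (`packetLogVol_le_card_mul_log_pi`) and for hull-sets inside it (`nlogVol_polydisc_le`).
Nothing here takes a side on [IUTchIII] Cor. 3.12.
-/

noncomputable section

namespace Literature.IUT.LogVolume

namespace ArchPacket

open MeasureTheory MeasureTheory.Measure Set Metric
open scoped ENNReal Pointwise

variable (J : Type) [Fintype J]

/-! ## The archimedean packet `⊕_{j∈J} ℂ` and its integral structure `B` -/

/-- The integral structure `B ⊆ ⊕_{j∈J} ℂ`: "the direct product of the unit balls of the copies of `ℂ` that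
occur in the direct sum decomposition" ([IUTchIV] Prop. 1.5 (iii), p. 15), `{y | ∀ j, |y_j| ≤ 1}`.
[claim: Mochizuki2012, status: disputed] -/
def unitBall : Set (J → ℂ) := {y | ∀ j, ‖y j‖ ≤ 1}

/-- The polydisc (hull-set) `⊕_j r_j·𝒪 = {y | ∀ j, |y_j| ≤ r_j}` ([IUTchIII] Rmk. 3.9.5 (i): hull-sets are
direct sums of multiples of the integral structures of the fields of the direct sum decomposition; at a
complex archimedean field `𝒪` is the closed unit disc). [claim: Mochizuki2012, status: disputed] -/
def polydisc (r : J → ℝ) : Set (J → ℂ) := {y | ∀ j, ‖y j‖ ≤ r j}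

omit [Fintype J] in
/-- The polydisc is the product set `Π_j closedBall 0 r_j`. (Mathlib-level
plumbing for the Step (vii) container computation, p. 30). [claim: Mochizuki2012, status: disputed] -/
theorem polydisc_eq_pi (r : J → ℝ) : polydisc J r = Set.univ.pi fun j => closedBall (0 : ℂ) (r j) := by
  ext y
  simp [polydisc]

/-- `B` is the closed unit ball of the sup norm (for `J ≠ ∅`). (Mathlib-level
plumbing for the Step (vii) container computation, p. 30). [claim: Mochizuki2012, status: disputed] -/
theorem unitBall_eq_closedBall [Nonempty J] : unitBall J = closedBall (0 : J → ℂ) 1 := by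
  ext y
  simp [unitBall, Metric.mem_closedBall, dist_zero_right, pi_norm_le_iff_of_nonneg zero_le_one]

/-- A positive multiple of `B` is a polydisc: `r·B = {y | ∀ j, |y_j| ≤ r}`. (Mathlib-level
plumbing for the Step (vii) container computation, p. 30). [claim: Mochizuki2012, status: disputed] -/
theorem smul_unitBall [Nonempty J] {r : ℝ} (hr : 0 ≤ r) : r • unitBall J = polydisc J fun _ => r := by
  rw [unitBall_eq_closedBall, smul_unitClosedBall_of_nonneg hr]
  ext y
  simp [polydisc, Metric.mem_closedBall, dist_zero_right, pi_norm_le_iff_of_nonneg hr]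

/-- `B` has positive volume. (Mathlib-level
plumbing for the Step (vii) container computation, p. 30). [claim: Mochizuki2012, status: disputed] -/
theorem volume_unitBall_pos [Nonempty J] : 0 < volume (unitBall J) := by
  rw [unitBall_eq_closedBall]
  exact Metric.measure_closedBall_pos volume _ one_pos

/-- `B` has finite volume. (Mathlib-level
plumbing for the Step (vii) container computation, p. 30). [claim: Mochizuki2012, status: disputed] -/
theorem volume_unitBall_lt_top [Nonempty J] : volume (unitBall J) < ∞ := by
  rw [unitBall_eq_closedBall]
  exact measure_closedBall_lt_top

/-- The real dimension of the packet: `dim_ℝ ⊕_{j∈J} ℂ = 2·|J|`. (Mathlib-level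
plumbing for the Step (vii) container computation, p. 30). [claim: Mochizuki2012, status: disputed] -/
theorem finrank_packet : Module.finrank ℝ (J → ℂ) = 2 * Fintype.card J := by
  rw [Module.finrank_pi_fintype ℝ (ι := J) (M := fun _ => ℂ)]
  simp [Complex.finrank_real_complex, Finset.sum_const, Finset.card_univ, mul_comm]

/-- The real dimension is positive for `J ≠ ∅` (plumbing, p. 30). [claim: Mochizuki2012, status: disputed] -/
theorem finrank_packet_pos [Nonempty J] : 0 < Module.finrank ℝ (J → ℂ) := by
  rw [finrank_packet]
  exact Nat.mul_pos two_pos Fintype.card_pos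

/-! ## The normalised log-volume -/

/-- **The normalised log-volume** on the archimedean packet: `(dim_ℝ)⁻¹·(log vol(S) − log vol(B))`, `vol` =
Lebesgue (Haar) measure; normalised as the text's "packet-normalization" ([IUTchIII] Prop. 3.9 (i)
pp. 115–116; p. 30: "the log-volume of `B_I` is equal to `0`") and equal to the printed normalized-weight sum
of radial log-volumes on polydiscs (`nlogVol_polydisc`; module docstring, MODELLING DECISION). Sets of
volume `0` or `∞` get the junk value `−(dim)⁻¹·log vol(B)` (Lean's `log 0 = 0`); the lemmas carry the
positivity/finiteness hypotheses they need. [claim: Mochizuki2012, status: disputed] -/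
def nlogVol (S : Set (J → ℂ)) : ℝ :=
  (Module.finrank ℝ (J → ℂ) : ℝ)⁻¹ *
    (Real.log (volume S).toReal - Real.log (volume (unitBall J)).toReal)

/-- NORMALISATION: `nlogVol B = 0` ("the log-volume of `B_I` is equal to `0`", p. 30).
[claim: Mochizuki2012, status: disputed] -/
theorem nlogVol_unitBall : nlogVol J (unitBall J) = 0 := by
  simp [nlogVol]

/-- SCALING: for `c ∈ ℝ^×` and `S` of positive finite volume, `nlogVol (c·S) = log|c| + nlogVol S`
(Haar measure scales by `|c|^{dim}`; [AbsTopIII] Prop. 5.7 (ii) (b) "`μ^log(x·A) = μ^log(A) + μ̇^log(x)`"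
on each summand, averaged). [claim: Mochizuki2012, status: disputed] -/
theorem nlogVol_smul [Nonempty J] {c : ℝ} (hc : c ≠ 0) {S : Set (J → ℂ)} (h0 : volume S ≠ 0)
    (htop : volume S ≠ ∞) : nlogVol J (c • S) = Real.log |c| + nlogVol J S := by
  have hd : (0 : ℝ) < Module.finrank ℝ (J → ℂ) := by exact_mod_cast finrank_packet_pos J
  have hvol : volume (c • S) = ENNReal.ofReal (|c| ^ Module.finrank ℝ (J → ℂ)) * volume S := by
    rw [addHaar_smul, abs_pow]
  have hS : 0 < (volume S).toReal := ENNReal.toReal_pos h0 htop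
  have hcpow : 0 < |c| ^ Module.finrank ℝ (J → ℂ) := pow_pos (abs_pos.mpr hc) _
  unfold nlogVol
  rw [hvol, ENNReal.toReal_mul, ENNReal.toReal_ofReal hcpow.le, Real.log_mul hcpow.ne' hS.ne',
    Real.log_pow]
  field_simp
  ring

/-- SCALING by a positive real: `nlogVol (r·S) = log r + nlogVol S`. [claim: Mochizuki2012, status: disputed] -/
theorem nlogVol_smul_of_pos [Nonempty J] {r : ℝ} (hr : 0 < r) {S : Set (J → ℂ)} (h0 : volume S ≠ 0)
    (htop : volume S ≠ ∞) : nlogVol J (r • S) = Real.log r + nlogVol J S := by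
  rw [nlogVol_smul J hr.ne' h0 htop, abs_of_pos hr]

/-- `e`-NORMALISATION ([IUTchIII] Prop. 3.9 (i), p. 116: "multiplication … by `e = 2.71828...`
corresponds to adding … `1 = log(e)`"): `nlogVol (e·S) = nlogVol S + 1`. [claim: Mochizuki2012, status: disputed] -/
theorem nlogVol_exp_one_smul [Nonempty J] {S : Set (J → ℂ)} (h0 : volume S ≠ 0) (htop : volume S ≠ ∞) :
    nlogVol J (Real.exp 1 • S) = nlogVol J S + 1 := by
  rw [nlogVol_smul_of_pos J (Real.exp_pos 1) h0 htop, Real.log_exp]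
  ring

/-- MONOTONICITY: `S ⊆ T`, `vol S > 0`, `vol T < ∞` ⟹ `nlogVol S ≤ nlogVol T` ("an upper bound on the
component of the log-volume … may be obtained by computing an upper bound for the log-volume of this
container", p. 30). [claim: Mochizuki2012, status: disputed] -/
theorem nlogVol_mono {S T : Set (J → ℂ)} (hST : S ⊆ T) (h0 : volume S ≠ 0) (htop : volume T ≠ ∞) :
    nlogVol J S ≤ nlogVol J T := by
  have hStop : volume S ≠ ∞ := ne_top_of_le_ne_top htop (measure_mono hST)
  have hS : 0 < (volume S).toReal := ENNReal.toReal_pos h0 hStop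
  have hle : (volume S).toReal ≤ (volume T).toReal := ENNReal.toReal_mono htop (measure_mono hST)
  unfold nlogVol
  have hd : (0 : ℝ) ≤ (Module.finrank ℝ (J → ℂ) : ℝ)⁻¹ := by positivity
  exact mul_le_mul_of_nonneg_left (sub_le_sub_right (Real.log_le_log hS hle) _) hd

/-- `nlogVol (r·B) = log r` for `r > 0`. [claim: Mochizuki2012, status: disputed] -/
theorem nlogVol_smul_unitBall [Nonempty J] {r : ℝ} (hr : 0 < r) : nlogVol J (r • unitBall J) = Real.log r := by
  rw [nlogVol_smul_of_pos J hr (volume_unitBall_pos J).ne' (volume_unitBall_lt_top J).ne, nlogVol_unitBall,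
    add_zero]

/-- `nlogVol (r^n·B) = n·log r` for `r > 0` — with `r = π`, `n = j+1` this is the printed bound
"`(j+1)·log(π)`" for the container `π^{j+1}·B_I` (p. 30). [claim: Mochizuki2012, status: disputed] -/
theorem nlogVol_pow_smul_unitBall [Nonempty J] {r : ℝ} (hr : 0 < r) (n : ℕ) :
    nlogVol J (r ^ n • unitBall J) = n * Real.log r := by
  rw [nlogVol_smul_unitBall J (pow_pos hr n), Real.log_pow]

/-! ## Hull-sets (polydiscs): the dimension-weighted average -/

/-- The volume of a polydisc is the product of the volumes of its discs. (Mathlib-level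
plumbing for the Step (vii) container computation, p. 30). [claim: Mochizuki2012, status: disputed] -/
theorem volume_polydisc (r : J → ℝ) :
    volume (polydisc J r) = ∏ j, volume (closedBall (0 : ℂ) (r j)) := by
  rw [polydisc_eq_pi, volume_pi_pi]

/-- In `ℂ`, `vol(closedBall 0 r) = r²·vol(closedBall 0 1)` for `r ≥ 0` (Haar scaling, `dim_ℝ ℂ = 2`).
[folklore] -/
private theorem volume_closedBall_complex {r : ℝ} (hr : 0 ≤ r) :
    volume (closedBall (0 : ℂ) r) = ENNReal.ofReal (r ^ 2) * volume (closedBall (0 : ℂ) 1) := by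
  rw [← smul_unitClosedBall_of_nonneg hr, addHaar_smul_of_nonneg volume hr, Complex.finrank_real_complex]

/-- A polydisc with positive radii has positive volume. (Mathlib-level
plumbing for the Step (vii) container computation, p. 30). [claim: Mochizuki2012, status: disputed] -/
theorem volume_polydisc_pos {r : J → ℝ} (hr : ∀ j, 0 < r j) : 0 < volume (polydisc J r) := by
  rw [volume_polydisc]
  exact pos_iff_ne_zero.mpr
    (Finset.prod_ne_zero_iff.mpr fun j _ => (Metric.measure_closedBall_pos volume _ (hr j)).ne')

/-- A polydisc has finite volume. (Mathlib-level
plumbing for the Step (vii) container computation, p. 30). [claim: Mochizuki2012, status: disputed] -/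
theorem volume_polydisc_lt_top (r : J → ℝ) : volume (polydisc J r) < ∞ := by
  rw [volume_polydisc]
  exact ENNReal.prod_lt_top fun j _ => measure_closedBall_lt_top

/-- **The log-volume of a hull-set is the AVERAGE of the log-radii**: for radii `r_j > 0`,
`nlogVol (⊕_j r_j·𝒪) = (1/|J|)·Σ_j log r_j` (the dimension-weighted average of the radial log-volumes of
the summands with the normalized weights, [IUTchIII] Prop. 3.9 (i) pp. 115–116; [AbsTopIII] Prop. 5.7
(ii) on each copy of `ℂ`).
[claim: Mochizuki2012, status: disputed] -/
theorem nlogVol_polydisc [Nonempty J] {r : J → ℝ} (hr : ∀ j, 0 < r j) :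
    nlogVol J (polydisc J r) = (Fintype.card J : ℝ)⁻¹ * ∑ j, Real.log (r j) := by
  have hB1 : 0 < (volume (closedBall (0 : ℂ) 1)).toReal :=
    ENNReal.toReal_pos (Metric.measure_closedBall_pos volume _ one_pos).ne' measure_closedBall_lt_top.ne
  have hprod : (volume (polydisc J r)).toReal =
      (∏ j, r j ^ 2) * (volume (closedBall (0 : ℂ) 1)).toReal ^ Fintype.card J := by
    rw [volume_polydisc, ENNReal.toReal_prod]
    simp_rw [volume_closedBall_complex (hr _).le, ENNReal.toReal_mul,
      ENNReal.toReal_ofReal (sq_nonneg _)]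
    rw [Finset.prod_mul_distrib, Finset.prod_const, Finset.card_univ]
  have hunit : (volume (unitBall J)).toReal = (volume (closedBall (0 : ℂ) 1)).toReal ^ Fintype.card J := by
    rw [show unitBall J = polydisc J (fun _ => 1) from rfl, volume_polydisc, ENNReal.toReal_prod,
      Finset.prod_const, Finset.card_univ]
  have hprodpos : 0 < ∏ j, r j ^ 2 := Finset.prod_pos fun j _ => pow_pos (hr j) 2
  have hpowpos : 0 < (volume (closedBall (0 : ℂ) 1)).toReal ^ Fintype.card J := pow_pos hB1 _
  have hJ : (Fintype.card J : ℝ) ≠ 0 := by exact_mod_cast Fintype.card_ne_zero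
  have hlog : Real.log (∏ j, r j ^ 2) = 2 * ∑ j, Real.log (r j) := by
    rw [Real.log_prod (fun j _ => (pow_pos (hr j) 2).ne'), Finset.mul_sum]
    refine Finset.sum_congr rfl fun j _ => ?_
    rw [Real.log_pow]
    push_cast
    ring
  unfold nlogVol
  rw [hprod, hunit, Real.log_mul hprodpos.ne' hpowpos.ne', add_sub_cancel_right, hlog, finrank_packet]
  push_cast
  field_simp

/-- A hull-set with radii `0 < r_j ≤ R` has `nlogVol ≤ log R` (average of logs `≤` the largest); with
`R = π^{j+1}` this is the Step (vii) bound for every hull-set inside the container `π^{j+1}·B_I`.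
[claim: Mochizuki2012, status: disputed] -/
theorem nlogVol_polydisc_le [Nonempty J] {r : J → ℝ} (hr : ∀ j, 0 < r j) {R : ℝ} (hR : ∀ j, r j ≤ R) :
    nlogVol J (polydisc J r) ≤ Real.log R := by
  rw [nlogVol_polydisc J hr]
  have hJ : (0 : ℝ) < Fintype.card J := by exact_mod_cast Fintype.card_pos
  have hsum : ∑ j, Real.log (r j) ≤ ∑ _j : J, Real.log R :=
    Finset.sum_le_sum fun j _ => Real.log_le_log (hr j) (hR j)
  rw [Finset.sum_const, Finset.card_univ, nsmul_eq_mul] at hsum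
  calc (Fintype.card J : ℝ)⁻¹ * ∑ j, Real.log (r j)
      ≤ (Fintype.card J : ℝ)⁻¹ * (Fintype.card J * Real.log R) :=
        mul_le_mul_of_nonneg_left hsum (by positivity)
    _ = Real.log R := by field_simp

/-- A polydisc with radii `≤ R` lies in `R·B` (`R ≥ 0`). (Mathlib-level
plumbing for the Step (vii) container computation, p. 30). [claim: Mochizuki2012, status: disputed] -/
theorem polydisc_subset_smul_unitBall [Nonempty J] {r : J → ℝ} {R : ℝ} (hR0 : 0 ≤ R) (hR : ∀ j, r j ≤ R) :
    polydisc J r ⊆ R • unitBall J := by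
  rw [smul_unitBall J hR0]
  intro y hy j
  exact (hy j).trans (hR j)

end ArchPacket

/-! ## Transport to `M_I` along a direct sum decomposition; the Step (vii) container -/

namespace Prop15iii

open MeasureTheory Set ArchPacket PiTensorProduct
open scoped ENNReal Pointwise

variable {I V : Type} {J : Type}

/-- A decomposition identifies `B_I = ball Φ` with the integral structure `B` of `⊕_{j∈J} ℂ`:
`Φ '' B_I = B`. [claim: Mochizuki2012, status: disputed] -/
theorem image_ball (Φ : Decomposition I V J) : (Φ : MI I V → (J → ℂ)) '' ball Φ = unitBall J := by
  ext y
  constructor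
  · rintro ⟨x, hx, rfl⟩
    exact hx
  · intro hy
    refine ⟨Φ.symm y, ?_, Φ.apply_symm_apply y⟩
    intro j
    rw [Φ.apply_symm_apply]
    exact hy j

/-- A decomposition commutes with real scaling of sets: `Φ '' (c·S) = c·(Φ '' S)`. (Mathlib-level
plumbing for the Step (vii) container computation, p. 30). [claim: Mochizuki2012, status: disputed] -/
theorem image_smul_eq (Φ : Decomposition I V J) (c : ℝ) (S : Set (MI I V)) :
    (Φ : MI I V → (J → ℂ)) '' (c • S) = c • ((Φ : MI I V → (J → ℂ)) '' S) := by
  ext y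
  constructor
  · rintro ⟨x, ⟨x', hx', rfl⟩, rfl⟩
    exact ⟨Φ x', ⟨x', hx', rfl⟩, by simp⟩
  · rintro ⟨y', ⟨x', hx', rfl⟩, rfl⟩
    exact ⟨c • x', ⟨x', hx', rfl⟩, by simp⟩

/-- **`B_I` does not depend on the decomposition** (Prop. 1.5 (iii) "unique": two decompositions differ by a
bijection of the index sets and coordinatewise `id`/`conj`, both of which preserve `|·|`).
[claim: Mochizuki2012, status: disputed] -/
theorem ball_eq_ball [Fintype J] [DecidableEq J] {J' : Type} [Fintype J'] [DecidableEq J']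
    (Φ : Decomposition I V J) (Φ' : Decomposition I V J') : ball Φ = ball Φ' := by
  have hu : Prop15iii_unique I V := prop15iii_unique_holds
  obtain ⟨e, c, h⟩ := hu J J' Φ Φ'
  ext x
  constructor
  · intro hx j'
    obtain ⟨j, rfl⟩ := e.surjective j'
    rw [h x j, norm_cj]
    exact hx j
  · intro hx j
    have := hx (e j)
    rw [h x j, norm_cj] at this
    exact this

/-- **The log-volume on `M_I`** (normalised: `B_I ↦ 0`, scaling by `c` adds `log|c|`), computed in the
coordinates of a direct sum decomposition `Φ`. [claim: Mochizuki2012, status: disputed] -/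
def packetLogVol [Fintype J] (Φ : Decomposition I V J) (S : Set (MI I V)) : ℝ :=
  nlogVol J ((Φ : MI I V → (J → ℂ)) '' S)

/-- "The log-volume of `B_I` is equal to `0`" (p. 30). [claim: Mochizuki2012, status: disputed] -/
theorem packetLogVol_ball [Fintype J] (Φ : Decomposition I V J) : packetLogVol Φ (ball Φ) = 0 := by
  rw [packetLogVol, image_ball, nlogVol_unitBall]

/-- Scaling on `M_I`: `packetLogVol (c·S) = log|c| + packetLogVol S` for `S` of positive finite volume
(in the coordinates of `Φ`). [claim: Mochizuki2012, status: disputed] -/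
theorem packetLogVol_smul [Fintype J] [Nonempty J] (Φ : Decomposition I V J) {c : ℝ} (hc : c ≠ 0)
    {S : Set (MI I V)} (h0 : volume ((Φ : MI I V → (J → ℂ)) '' S) ≠ 0)
    (htop : volume ((Φ : MI I V → (J → ℂ)) '' S) ≠ ∞) :
    packetLogVol Φ (c • S) = Real.log |c| + packetLogVol Φ S := by
  rw [packetLogVol, image_smul_eq, nlogVol_smul J hc h0 htop, packetLogVol]

/-- `packetLogVol (r^n·B_I) = n·log r` (`r > 0`). [claim: Mochizuki2012, status: disputed] -/
theorem packetLogVol_pow_smul_ball [Fintype J] [Nonempty J] (Φ : Decomposition I V J) {r : ℝ}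
    (hr : 0 < r) (n : ℕ) :
    packetLogVol Φ (r ^ n • ball Φ) = n * Real.log r := by
  rw [packetLogVol, image_smul_eq, image_ball, nlogVol_pow_smul_unitBall J hr n]

/-- **The Step (vii) container, `≤`-form of Prop. 1.5 (iv)**: if every `ℂ_v`-component of every `m_i` has
length `≤ r` (`r > 0`) — e.g. `m_i` in the log-shell, the closed ball of radius `π` — then
`⊗_i m_i ∈ r^{|I|}·B_I` ("this “container of possible images” contains the elements of `M_I` obtained by
forming the tensor product of elements of the log-shells under consideration", p. 30).
[claim: Mochizuki2012, status: disputed] -/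
theorem tprod_mem_pow_smul_ball_of_norm_le [Fintype I] [DecidableEq I] [Fintype V] [DecidableEq V]
    (Φ : Decomposition I V J) {r : ℝ} (hr : 0 < r) (m : I → M V) (hm : ∀ i v, ‖m i v‖ ≤ r) :
    tprod ℝ m ∈ r ^ Fintype.card I • ball Φ := by
  refine ⟨(r ^ Fintype.card I)⁻¹ • tprod ℝ m, fun j => ?_, ?_⟩
  · obtain ⟨w, hw⟩ := norm_coord_tprod Φ j m
    rw [map_smul, Pi.smul_apply, norm_smul, hw, Real.norm_eq_abs, abs_inv, abs_pow, abs_of_pos hr]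
    have hprod : ∏ i, ‖m i (w i)‖ ≤ r ^ Fintype.card I := by
      calc ∏ i, ‖m i (w i)‖ ≤ ∏ _i : I, r :=
            Finset.prod_le_prod (fun i _ => norm_nonneg _) fun i _ => hm i (w i)
        _ = r ^ Fintype.card I := by rw [Finset.prod_const, Finset.card_univ]
    have hrpow : 0 < r ^ Fintype.card I := pow_pos hr _
    rw [inv_mul_le_iff₀ hrpow, mul_one]
    exact hprod
  · simp only [smul_smul, mul_inv_cancel₀ (pow_ne_zero _ hr.ne'), one_smul]

/-- The log-shell form: components of length `≤ π` give `⊗_i m_i ∈ π^{|I|}·B_I` (p. 30, with `|I| = j+1`).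
[claim: Mochizuki2012, status: disputed] -/
theorem tprod_mem_pi_pow_smul_ball [Fintype I] [DecidableEq I] [Fintype V] [DecidableEq V]
    (Φ : Decomposition I V J) (m : I → M V) (hm : ∀ i v, ‖m i v‖ ≤ Real.pi) :
    tprod ℝ m ∈ Real.pi ^ Fintype.card I • ball Φ :=
  tprod_mem_pow_smul_ball_of_norm_le Φ Real.pi_pos m hm

/-- **Step (vii): the log-volume of the container `π^{|I|}·B_I` is `|I|·log(π)`** ("Such an upper bound
`(j+1)·log(π)` follows immediately from the fact that … the log-volume of `B_I` is equal to `0`", p. 30;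
`|I| = j+1`). [claim: Mochizuki2012, status: disputed] -/
theorem packetLogVol_pi_pow_smul_ball [Fintype I] [Fintype J] [Nonempty J] (Φ : Decomposition I V J) :
    packetLogVol Φ (Real.pi ^ Fintype.card I • ball Φ) = Fintype.card I * Real.log Real.pi :=
  packetLogVol_pow_smul_ball Φ Real.pi_pos _

/-- With `|I| = j + 1` literally: `packetLogVol Φ (π^{j+1}·B_I) = (j+1)·log(π)`.
[claim: Mochizuki2012, status: disputed] -/
theorem packetLogVol_pi_pow_smul_ball_of_card [Fintype I] [Fintype J] [Nonempty J]
    (Φ : Decomposition I V J) {j : ℕ}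
    (hI : Fintype.card I = j + 1) :
    packetLogVol Φ (Real.pi ^ (j + 1) • ball Φ) = ((j : ℝ) + 1) * Real.log Real.pi := by
  rw [← hI, packetLogVol_pi_pow_smul_ball Φ, hI]
  push_cast
  ring

/-- **Step (vii), the bound for an arbitrary container**: any `C ⊆ π^{|I|}·B_I` of positive volume (in the
coordinates of `Φ`) has log-volume `≤ |I|·log(π)` ("an upper bound on the component of the log-volume under
consideration may be obtained by computing an upper bound for the log-volume of this container", p. 30).
[claim: Mochizuki2012, status: disputed] -/
theorem packetLogVol_le_card_mul_log_pi [Fintype I] [Fintype J] [Nonempty J] (Φ : Decomposition I V J)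
    {C : Set (MI I V)}
    (hC : C ⊆ Real.pi ^ Fintype.card I • ball Φ) (hC0 : volume ((Φ : MI I V → (J → ℂ)) '' C) ≠ 0) :
    packetLogVol Φ C ≤ Fintype.card I * Real.log Real.pi := by
  rw [← packetLogVol_pi_pow_smul_ball Φ, packetLogVol, packetLogVol]
  refine nlogVol_mono J (image_mono hC) hC0 ?_
  rw [image_smul_eq, image_ball, smul_unitBall J (pow_pos Real.pi_pos _).le]
  exact (volume_polydisc_lt_top J _).ne

end Prop15iii

end Literature.IUT.LogVolume

end
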